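import Literature.Barriers.QuantumAdvantage.PPolyOraclesThm76
import Literature.Computability.Cryptography.ZhandryOracle
import Literature.Computability.QuantumComplexity.OracleSeparationBQPBPP
import Literature.Computability.QuantumComplexity.OracleSeparationBQPPHProofs
import HarnessLib

/-!
# Aaronson–Chen 2017, Thm. 7.6 from a secure PRP: a construction-agnostic diagonalization (content signatures), proved, with the Zhandry instantiation

Sibling proof file of `Literature/Barriers/QuantumAdvantage/PPolyOraclesProofs.lean`, working
towards its leaf `aaronsonChen2017_thm76_of_prp : PRPExist → PPolyOracleSeparation` ("Assuming
one-way functions exist, there exists an oracle `O ∈ P/poly` such that `BPP^O ≠ BQP^O`", Thm. 7.6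
of S. Aaronson, L. Chen, CCC 2017, arXiv:1612.05903 [AaronsonChen2017], once Lemma 7.4 has
supplied the secure pseudorandom permutation `PRP^raw`).

**Relation to `PPolyOraclesThm76.lean`.** That sibling (a parallel decomposition of the same leaf)
proves the diagonalization for ONE encoding of Zhandry's oracle (`acLang`, level tables
`Tbl ℓ n`) from five leaves stated for that encoding. The present file isolates the
diagonalization from the construction: its main theorem `pPolyOracleSeparation_of_sig` is stated
for an arbitrary *content signature* (what a level may hold, which levels count as permutation
levels, and the three hypotheses — quantum machine, stage lemma, `P/poly` bound — any
instantiation must supply), over the level encoding of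
`Literature/Computability/Cryptography/ZhandryOracle.lean`. [AaronsonChen2017] (§1, pp. 9 and 11)
credit the construction to "Zhandry and (independently) Servedio and Gortler": Zhandry's `PRF^mod`
(period `a`, Shor/Boneh–Lipton) is the instantiation given below from the leaves of
`ZhandryOracle.lean`; the Servedio–Gortler variant (XOR masks, Simon's algorithm), whose leaves
are the tractable ones in the tree's models, is to instantiate the same theorem.

**What is proved here.**

1. A GENERIC oracle diagonalization (`pPolyOracleSeparation_of_sig`): for any *content
   signature* `S` (a type of level contents with a filler, a world bit `isPerm`, block lengths,
   level functions and a well-formedness predicate; the oracle of a content assignment is the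
   union of the level blocks of `ZhandryOracle.lean`), the three hypotheses
   `SigQuantum S` (a uniform `BQP^O` family accepts well-formed permutation levels with
   probability `≥ 2/3` and the other well-formed levels with probability `≤ 1/3`),
   `SigStage S` (every polynomial-time `BPP^O` description is defeated, at every large fresh
   level and against every finite frozen history, by some well-formed content) and
   `SigPPoly S` (oracles of well-formed assignments are in `P/poly`) give an oracle language
   `O ∈ P/poly` with `BPP^O ≠ BQP^O`. Nothing in this part is specific to Zhandry's
   construction (the Servedio–Gortler/Simon variant of the construction, credited in
   [AaronsonChen2017] §1, instantiates it equally).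
2. The ZHANDRY INSTANTIATION (`zhandrySig F κ ℓ`, contents `LevelContent` of
   `ZhandryOracle.lean`): `SigStage` from Lemma 7.5 (1)
   (`Literature.Computability.Cryptography.aaronsonChen2017_lem75_prp_isPRF`,
   `Literature.Computability.Cryptography.aaronsonChen2017_lem75_prfMod_isPRF`, through
   `aaronsonChen2017_lem75_eventually_le`) and the PPT simulation
   `Literature.Computability.Cryptography.aaronsonChen2017_thm76_bppMachine` (the stage lemma
   `exists_defeating_content`); `SigQuantum` from
   `Literature.Computability.Cryptography.aaronsonChen2017_lem75_quantum`; `SigPPoly` from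
   `Literature.Computability.Cryptography.aaronsonChen2017_thm76_memPPoly`; hence
   `aaronsonChen2017_thm76_of_prp_of_sig_leaves`: the leaf from its five named facts (and the
   discharged `countable_polyTimeOracleAlg_holds`).

**The argument** (Thm. 7.6, proof, p. 30), in the deterministic stage-wise form of Ko 1989, §3,
exactly as the tree's `exists_oracle_BQPRel_not_subset_BPPRel_of` (Bernstein–Vazirani / Raz–Tal):
the printed proof draws every level of the oracle at random (`PRP^raw_k` or `PRF^mod_{(k,a)}` with
probability `½`, random keys) and shows that each fixed `BPP` machine is correct at `0ⁿ` with
probability `½ + o(1)`, "even conditioning on" the earlier levels, whence `L ∉ BPP^O` almost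
surely; here the same estimate is used one machine at a time to CHOOSE the levels.

* *Stage lemma* (`exists_defeating_content`): fix a polynomial-time `P^O` machine `M` with bound
  `q`, a coin polynomial `p` (a candidate `BPP^O` decider, Arora–Barak Def. 7.3), and the finite
  data `(E, T)` of the levels treated so far. By `aaronsonChen2017_thm76_bppMachine` the acceptance
  probability of `(M, q, p)` at `1ⁿ` against the stage oracle with level `n` set to `f`
  (`specLang E T n (ℓ n) f`) is the acceptance probability of ONE PPT oracle adversary `𝒜` given
  oracle access to `f`; by Lemma 7.5 (1) the averages of this probability over `f = PRP^raw_k`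
  (`k` uniform) and over `f = PRF^mod_{(k,a)}` (`(k, a)` uniform) differ by at most `1/6` for all
  large `n`; hence NOT every key `k` gives acceptance `≥ 2/3` while every key `(k, a)` gives
  acceptance `≤ 1/3`: some content (a `prp k` accepted with probability `< 2/3`, or a
  `prfmod k a` accepted with probability `> 1/3`) defeats `(M, q, p)` at level `n`.
* *Diagonalization* (`diagSeq`, `diagC`): enumerate the descriptions `(M, q, p)`
  (`exists_enum_PHDescr`); stage `i` works at a fresh level `n_i` beyond everything frozen so far
  and beyond the threshold of `SigStage` for the current finite data, writes the defeating content
  there, and freezes all levels up to the reach of the description at `1^{n_i}` (locality of oracle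
  machines, the sibling's `accAt_congr`). Untreated levels keep the filler.
* *Assembly*: `O = S.oracle diagC ∈ P/poly` (`SigPPoly`, all contents being well formed);
  `L = {x : N₀ ≤ |x|, isPerm (diagC |x|)} ∈ BQP^O` (`SigQuantum`); and a `BPP^O` machine for `L`
  would be some `(M, q, p)` of the enumeration, defeated at its stage.

## Design notes

* Probe input `1ⁿ = unaryEncodeNat n` (the tree's security-parameter convention); the separating
  language depends only on the length.
* The reach of `(M, q, p)` at length `n` is `PHDescr.reach ⟨[p], M, q⟩ n` of the Raz–Tal file; a
  level-`m` string is longer than `2m + 1`, so freezing the levels `≤ reach` freezes every string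
  the description can read (`ContentSig.mem_oracle_congr`).
* The enumeration `e : ℕ → PHDescr` covers all descriptions with a polynomial-time machine; at the
  other indices the stage writes the filler (`SigStage` is only asked of polynomial-time `M`:
  classical security is against PPT adversaries).

## What remains for `aaronsonChen2017_thm76_of_prp_holds`

Along the Zhandry instantiation, the five leaves: `aaronsonChen2017_lem75_prp_isPRF` (PRP/PRF
switching lemma), `aaronsonChen2017_lem75_prfMod_isPRF` (Zhandry 2012, Claim 1),
`aaronsonChen2017_lem75_quantum` (Boneh–Lipton period finding as a uniform Clifford+T oracle
family), `aaronsonChen2017_thm76_bppMachine` (the PPT simulation) and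
`aaronsonChen2017_thm76_memPPoly`. The generic theorem also accepts any other instantiation.

## Sources

* [AaronsonChen2017] arXiv:1612.05903 (read via `lit read arxiv:1612.05903`): §1 (pp. 9, 11:
  "adapting constructions due to Zhandry and (independently) Servedio and Gortler"), §7.2, Lemma 7.5
  (pp. 29–30), Thm. 7.6 and its proof (p. 30), App. 13 (p. 42).
* [Ko1989] K.-I Ko, *Constructing oracles by lower bound techniques for circuits*, §3 (stage-wise
  oracle constructions), through the tree's `diagSeq` pattern (`OracleSeparationBQPPH.lean`).
* [BakerGillSolovay1975], [AroraBarak2009] §3.4, Def. 7.3, through `baseLang`,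
  `uniformProb_baseLang_congr`, `baseLang_eq_of_PRel`.
-/

noncomputable section

namespace Literature.Barriers.QuantumAdvantage

open _root_.Computability Literature.Computability.Complexity Literature.Computability.Cryptography
open Literature.Computability.QuantumComplexity (baseLang PHDescr levelReach truncLang
  uniformProb_baseLang_congr baseLang_eq_of_PRel exists_enum_PHDescr countable_polyTimeOracleAlg_holds)
open Finset

/-! ### The acceptance probability of a description `(M, q, p)` at the probe `1ⁿ` -/

/-- The written-out form of `Literature.Computability.Cryptography.aaronsonChen2017_thm76_bppMachine`
is the sibling's `accAt` (probe `1ⁿ = List.replicate n true = unaryEncodeNat n`; the cut-off oracle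
of `baseLang` is `truncLang`, definitionally). [folklore] -/
theorem accAt_eq_run (M : OracleAlg Bool) (q p : Polynomial ℕ) (O : Language Bool) (n : ℕ) :
    accAt M q p O n =
      uniformProb (p.eval n) {r : List Bool |
        M.run (Oracle.ofLanguage {s : List Bool | s ∈ O ∧
            s.length ≤ q.eval (boolPair (unaryEncodeNat n) r).length})
          (q.eval (boolPair (unaryEncodeNat n) r).length) (boolPair (unaryEncodeNat n) r) =
          some true} := by
  rw [OracleCompose.unaryEncodeNat_eq_replicate]
  rfl

/-! ### Content signatures and their oracles (the generic part) -/

/-- **A content signature**: what the generic diagonalization needs to know about the levels of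
the oracle — a type `Γ` of level contents with a distinguished `filler` (the content of untreated
levels: the identity permutation of `{0,1}ⁿ`), the world bit `isPerm` (membership of the length in
the separating language), the block length and level function of a content at level `n` (read by
`levelStrings`), and the well-formedness predicate under which the quantum machine and the
`P/poly` bound are asked to work. Zhandry's construction (`LevelContent`: `PRP^raw_k`,
`PRF^mod_{(k,a)}`) is the instance `zhandrySig`. [cite: AaronsonChen2017, Thm. 7.6 (proof, p. 30)] -/
structure ContentSig where
  /-- The type of level contents. -/
  Γ : Type
  /-- The content of an untreated level. -/
  filler : Γ
  /-- The world bit: `true` iff the level function is a permutation. -/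
  isPerm : Γ → Bool
  /-- The block length of a content at level `n`. -/
  blockLen : ℕ → Γ → ℕ
  /-- The level function of a content at level `n`. -/
  fn : ℕ → Γ → List Bool → List Bool
  /-- Well-formed contents (right key lengths, admissible auxiliary keys). -/
  WellFormed : ℕ → Γ → Prop
  /-- The filler has block length `n`. -/
  blockLen_filler : ∀ n, blockLen n filler = n
  /-- The filler is the identity. -/
  fn_filler : ∀ n, fn n filler = id
  /-- The filler is well formed. -/
  wellFormed_filler : ∀ n, WellFormed n filler

namespace ContentSig

variable (S : ContentSig)

/-- The level block of a content at level `n`. [cite: AaronsonChen2017, Thm. 7.6 (proof, p. 30)] -/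
def strings (n : ℕ) (c : S.Γ) : Set (List Bool) :=
  levelStrings n (S.blockLen n c) (S.fn n c)

/-- The block of the filler is the identity block of length `n`. [folklore] -/
theorem strings_filler (n : ℕ) : S.strings n S.filler = levelStrings n n id := by
  simp [strings, S.blockLen_filler, S.fn_filler]

/-- **The oracle of a content assignment**: the union of the level blocks.
[cite: AaronsonChen2017, Thm. 7.6 (proof, p. 30)] -/
def oracle (C : ℕ → S.Γ) : Language Bool :=
  {w | ∃ n, w ∈ S.strings n (C n)}

/-- Unfolding lemma. [folklore] -/
theorem mem_oracle_iff (C : ℕ → S.Γ) (w : List Bool) :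
    w ∈ S.oracle C ↔ ∃ n, w ∈ S.strings n (C n) :=
  Iff.rfl

/-- On the level-`n` domain the oracle is the level-`n` block. [folklore] -/
theorem mem_oracle_iff_of_mem_levelDomain (C : ℕ → S.Γ) {n : ℕ} {w : List Bool}
    (hw : w ∈ levelDomain n) : w ∈ S.oracle C ↔ w ∈ S.strings n (C n) := by
  constructor
  · rintro ⟨n', hn'⟩
    have : n' = n :=
      eq_of_mem_levelDomain (levelStrings_subset_levelDomain _ _ _ hn') hw
    subst this
    exact hn'
  · exact fun h => ⟨n, h⟩

/-- Changing the contents at levels `≥ R` does not change the oracle on strings of length `≤ R`.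
[folklore] -/
theorem mem_oracle_congr {C C' : ℕ → S.Γ} {R : ℕ} (h : ∀ m, m < R → C m = C' m) {w : List Bool}
    (hw : w.length ≤ R) : w ∈ S.oracle C ↔ w ∈ S.oracle C' := by
  constructor
  · rintro ⟨m, hm⟩
    have hlt : m < R := by
      have := length_of_mem_levelStrings hm
      omega
    exact ⟨m, by rw [← h m hlt]; exact hm⟩
  · rintro ⟨m, hm⟩
    have hlt : m < R := by
      have := length_of_mem_levelStrings hm
      omega
    exact ⟨m, by rw [h m hlt]; exact hm⟩

end ContentSig

namespace ContentSig

/-! ### The three hypotheses of the generic diagonalization -/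

/-- **Quantum side.** From some threshold on, for every `n₀`, a poly-time uniform family of
Clifford+T oracle circuits rejects (probability `≤ 1/3`) all inputs shorter than `n₀` and, on an
input `x` with `|x| ≥ n₀`, relative to any oracle whose level-`|x|` block is that of a well-formed
content `c`, accepts with probability `≥ 2/3` if `isPerm c` and `≤ 1/3` otherwise (the shape of
Lemma 7.5 (2)–(3) with the hard-wiring of the proof of Thm. 7.6).
[cite: AaronsonChen2017, Lemma 7.5 and Thm. 7.6 (proof, p. 30)] -/
def SigQuantum (S : ContentSig) : Prop :=
  ∃ N₁ : ℕ, ∀ n₀ : ℕ, N₁ ≤ n₀ →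
    ∃ D : QCircuitFamily cliffordT, D.IsUniform ∧
      (∀ (O : Language Bool) (x : List Bool), x.length < n₀ → D.acceptProbOn O x ≤ 1 / 3) ∧
      ∀ (O : Language Bool) (x : List Bool), n₀ ≤ x.length → ∀ c : S.Γ, S.WellFormed x.length c →
        (∀ w ∈ levelDomain x.length, w ∈ O ↔ w ∈ S.strings x.length c) →
          (S.isPerm c = true → 2 / 3 ≤ D.acceptProbOn O x) ∧
          (S.isPerm c = false → D.acceptProbOn O x ≤ 1 / 3)

/-- A content `c` **defeats** the description `(M, q, p)` at level `n` against the finite data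
`(E, T)`: it is well formed and the acceptance probability at `1ⁿ` against the stage oracle with
level `n` set to `c` is on the wrong side of the `BPP` promise for the verdict `isPerm c`
(`< 2/3` although `1ⁿ ∈ L`, resp. `> 1/3` although `1ⁿ ∉ L`). [cite: AaronsonChen2017, Thm. 7.6 (proof, p. 30)] -/
def Defeats (S : ContentSig) (E : Finset ℕ) (T : Finset (List Bool)) (M : OracleAlg Bool) (q p : Polynomial ℕ)
    (n : ℕ) (c : S.Γ) : Prop :=
  S.WellFormed n c ∧
    (S.isPerm c = true → accAt M q p (specLang E T n (S.blockLen n c) (S.fn n c)) n < 2 / 3) ∧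
    (S.isPerm c = false → 1 / 3 < accAt M q p (specLang E T n (S.blockLen n c) (S.fn n c)) n)

/-- **Classical side (the stage lemma as a hypothesis).** For every polynomial-time `P^O` machine
`M` with bounds `q, p` and every finite history `(E, T)`, from some level on every fresh level
carries a defeating content. [cite: AaronsonChen2017, Thm. 7.6 (proof, p. 30)] -/
def SigStage (S : ContentSig) : Prop :=
  ∀ (M : OracleAlg Bool), M.IsPolyTime encodingBoolBool →
    ∀ (q p : Polynomial ℕ) (E : Finset ℕ) (T : Finset (List Bool)),
      ∃ n₁ : ℕ, ∀ n, n₁ ≤ n → n ∉ E → ∃ c : S.Γ, S.Defeats E T M q p n c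

/-- **`P/poly` side.** Oracles of well-formed assignments are decided by polynomial-size circuit
families. [cite: AaronsonChen2017, Thm. 7.6 (proof, p. 30)] -/
def SigPPoly (S : ContentSig) : Prop :=
  ∀ C : ℕ → S.Γ, (∀ n, S.WellFormed n (C n)) → S.oracle C ∈ PPoly

end ContentSig

/-! ### The stages -/

section Diag

variable (S : ContentSig)

/-- A state of the stage-wise construction: the current content assignment and the first free
level (all lower levels are frozen; all levels from `lvl` on still carry the filler).
[cite: Ko1989, §3] -/
structure ZState where
  /-- The current content of every level. -/
  C : ℕ → S.Γ
  /-- Levels below `lvl` are frozen. -/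
  lvl : ℕ

variable {S}

/-- The treated levels of a state: the levels below `lvl` whose content is not the filler (a
finite set). [cite: Ko1989, §3] -/
def ZState.treated (s : ZState S) : Finset ℕ :=
  open scoped Classical in (Finset.range s.lvl).filter fun m => s.C m ≠ S.filler

/-- The blocks of the treated levels form a finite set of strings. [folklore] -/
theorem ZState.finite_tableSet (s : ZState S) :
    {w : List Bool | ∃ m ∈ s.treated, w ∈ S.strings m (s.C m)}.Finite := by
  have h : {w : List Bool | ∃ m ∈ s.treated, w ∈ S.strings m (s.C m)} =
      ⋃ m ∈ (s.treated : Set ℕ), S.strings m (s.C m) := by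
    ext w; simp
  rw [h]
  exact s.treated.finite_toSet.biUnion fun m _ => levelStrings_finite _ _ _

/-- The hard-wired table of a state: the (finite) union of the blocks of its treated levels.
[cite: AaronsonChen2017, Thm. 7.6 (proof, p. 30)] -/
def ZState.table (s : ZState S) : Finset (List Bool) :=
  s.finite_tableSet.toFinset

/-- Membership in the hard-wired table. [folklore] -/
theorem ZState.mem_table {s : ZState S} {w : List Bool} :
    w ∈ s.table ↔ ∃ m ∈ s.treated, w ∈ S.strings m (s.C m) := by
  simp [ZState.table]

/-- Membership in the treated set. [folklore] -/
theorem ZState.mem_treated {s : ZState S} {m : ℕ} :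
    m ∈ s.treated ↔ m < s.lvl ∧ s.C m ≠ S.filler := by
  classical
  simp [ZState.treated]

variable (S)
variable (N₀ : ℕ) (thr : Finset ℕ → Finset (List Bool) → PHDescr → ℕ)
  (pick : Finset ℕ → Finset (List Bool) → PHDescr → ℕ → S.Γ) (e : ℕ → PHDescr)

/-- **The stages** (Ko 1989, §3, for the proof of Thm. 7.6): stage `i` treats the `i`-th
description `e i` at the level `n_i = max lvl (thr E T (e i))` (free, and large enough for the
stage lemma with the current finite data `E = treated`, `T = table`), writes the content
`pick E T (e i) n_i` there, and freezes every level the description may read at the probe `1^{n_i}`.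
[cite: Ko1989, §3] [cite: AaronsonChen2017, Thm. 7.6 (proof, p. 30)] -/
def diagSeq : ℕ → ZState S
  | 0 => ⟨fun _ => S.filler, N₀⟩
  | i + 1 =>
    let s := diagSeq i
    let n := max s.lvl (thr s.treated s.table (e i))
    ⟨Function.update s.C n (pick s.treated s.table (e i) n),
      max (n + 1) ((e i).reach n + 1)⟩

/-- The level `n_i` treated at stage `i`. [cite: Ko1989, §3] -/
def stageLvl (i : ℕ) : ℕ :=
  max (diagSeq S N₀ thr pick e i).lvl
    (thr (diagSeq S N₀ thr pick e i).treated (diagSeq S N₀ thr pick e i).table (e i))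

/-- The content written at stage `i`. [cite: AaronsonChen2017, Thm. 7.6 (proof, p. 30)] -/
def stagePick (i : ℕ) : S.Γ :=
  pick (diagSeq S N₀ thr pick e i).treated (diagSeq S N₀ thr pick e i).table (e i)
    (stageLvl S N₀ thr pick e i)

/-- **The limit assignment**: level `n` is frozen from stage `n + 1` on, so its final content is
the one it holds after stage `n`. [cite: Ko1989, §3] -/
def diagC (n : ℕ) : S.Γ :=
  (diagSeq S N₀ thr pick e (n + 1)).C n

/-- The assignment after stage `i`. [cite: Ko1989, §3] -/
theorem diagSeq_succ_C (i : ℕ) :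
    (diagSeq S N₀ thr pick e (i + 1)).C =
      Function.update (diagSeq S N₀ thr pick e i).C (stageLvl S N₀ thr pick e i)
        (stagePick S N₀ thr pick e i) :=
  rfl

/-- The frozen prefix after stage `i`. [cite: Ko1989, §3] -/
theorem diagSeq_succ_lvl (i : ℕ) :
    (diagSeq S N₀ thr pick e (i + 1)).lvl =
      max (stageLvl S N₀ thr pick e i + 1) ((e i).reach (stageLvl S N₀ thr pick e i) + 1) :=
  rfl

/-- Stage `i` works at a free level. [cite: Ko1989, §3] -/
theorem lvl_le_stageLvl (i : ℕ) : (diagSeq S N₀ thr pick e i).lvl ≤ stageLvl S N₀ thr pick e i :=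
  le_max_left _ _

/-- Stage `i` works beyond the threshold of the stage lemma for its data. [cite: Ko1989, §3] -/
theorem thr_le_stageLvl (i : ℕ) :
    thr (diagSeq S N₀ thr pick e i).treated (diagSeq S N₀ thr pick e i).table (e i) ≤
      stageLvl S N₀ thr pick e i :=
  le_max_right _ _

/-- The level of stage `i` is frozen afterwards. [cite: Ko1989, §3] -/
theorem stageLvl_lt_lvl_succ (i : ℕ) :
    stageLvl S N₀ thr pick e i < (diagSeq S N₀ thr pick e (i + 1)).lvl := by
  rw [diagSeq_succ_lvl]; omega

/-- Everything the `i`-th description read at its probe is frozen afterwards. [cite: Ko1989, §3] -/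
theorem reach_lt_lvl_succ_sig (i : ℕ) :
    (e i).reach (stageLvl S N₀ thr pick e i) < (diagSeq S N₀ thr pick e (i + 1)).lvl := by
  rw [diagSeq_succ_lvl]; omega

/-- The frozen prefix grows by at least one level per stage. [folklore] -/
theorem add_le_lvl (i : ℕ) : N₀ + i ≤ (diagSeq S N₀ thr pick e i).lvl := by
  induction i with
  | zero => exact le_rfl
  | succ i ih =>
    have h1 := lvl_le_stageLvl S N₀ thr pick e i
    have h2 := stageLvl_lt_lvl_succ S N₀ thr pick e i
    omega

/-- The frozen prefix only grows. [cite: Ko1989, §3] -/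
theorem lvl_mono {i j : ℕ} (hij : i ≤ j) :
    (diagSeq S N₀ thr pick e i).lvl ≤ (diagSeq S N₀ thr pick e j).lvl := by
  induction hij with
  | refl => exact le_rfl
  | step _ ih =>
    exact ih.trans ((lvl_le_stageLvl S N₀ thr pick e _).trans
      (stageLvl_lt_lvl_succ S N₀ thr pick e _).le)

/-- **Freezing**: a level below `lvl_i` keeps its content at all later stages. [cite: Ko1989, §3] -/
theorem C_eq_of_lt_lvl {n i j : ℕ} (hn : n < (diagSeq S N₀ thr pick e i).lvl) (hij : i ≤ j) :
    (diagSeq S N₀ thr pick e j).C n = (diagSeq S N₀ thr pick e i).C n := by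
  induction hij with
  | refl => rfl
  | @step j hij ih =>
    rw [diagSeq_succ_C, Function.update_of_ne, ih]
    have h1 := lvl_mono S N₀ thr pick e hij
    have h2 := lvl_le_stageLvl S N₀ thr pick e j
    omega

/-- The limit content of a level frozen at stage `j` is its stage-`j` content. [cite: Ko1989, §3] -/
theorem diagC_eq_of_lt_lvl {n j : ℕ} (hn : n < (diagSeq S N₀ thr pick e j).lvl) :
    diagC S N₀ thr pick e n = (diagSeq S N₀ thr pick e j).C n := by
  unfold diagC
  rcases le_total j (n + 1) with h | h
  · exact C_eq_of_lt_lvl S N₀ thr pick e hn h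
  · have hn' : n < (diagSeq S N₀ thr pick e (n + 1)).lvl :=
      lt_of_lt_of_le (by omega) (add_le_lvl S N₀ thr pick e (n + 1))
    exact (C_eq_of_lt_lvl S N₀ thr pick e hn' h).symm

/-- The limit content at a stage level is the content written at that stage. [cite: Ko1989, §3] -/
theorem diagC_stageLvl (i : ℕ) :
    diagC S N₀ thr pick e (stageLvl S N₀ thr pick e i) = stagePick S N₀ thr pick e i := by
  rw [diagC_eq_of_lt_lvl S N₀ thr pick e (stageLvl_lt_lvl_succ S N₀ thr pick e i),
    diagSeq_succ_C, Function.update_self]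

/-- **Levels from `lvl` on are untouched**: they carry the filler. [cite: Ko1989, §3] -/
theorem C_eq_filler_of_lvl_le (i : ℕ) {m : ℕ} (hm : (diagSeq S N₀ thr pick e i).lvl ≤ m) :
    (diagSeq S N₀ thr pick e i).C m = S.filler := by
  induction i with
  | zero => rfl
  | succ i ih =>
    have h1 := stageLvl_lt_lvl_succ S N₀ thr pick e i
    have h2 := lvl_le_stageLvl S N₀ thr pick e i
    rw [diagSeq_succ_C, Function.update_of_ne (by omega)]
    exact ih (by omega)

/-- Every content ever present is the filler or a written pick. [folklore] -/
theorem C_eq_filler_or (i m : ℕ) :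
    (diagSeq S N₀ thr pick e i).C m = S.filler ∨
      ∃ j, stageLvl S N₀ thr pick e j = m ∧
        (diagSeq S N₀ thr pick e i).C m = stagePick S N₀ thr pick e j := by
  induction i with
  | zero => exact Or.inl rfl
  | succ i ih =>
    by_cases hj : stageLvl S N₀ thr pick e i = m
    · refine Or.inr ⟨i, hj, ?_⟩
      rw [diagSeq_succ_C, ← hj, Function.update_self]
    · rw [diagSeq_succ_C, Function.update_of_ne (Ne.symm hj)]
      exact ih

/-- Every limit content is the filler or the pick of the stage that treated its level. [folklore] -/
theorem diagC_eq_filler_or (n : ℕ) :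
    diagC S N₀ thr pick e n = S.filler ∨
      ∃ j, stageLvl S N₀ thr pick e j = n ∧ diagC S N₀ thr pick e n = stagePick S N₀ thr pick e j :=
  C_eq_filler_or S N₀ thr pick e (n + 1) n

/-- After stage `i` the oracle no longer changes on strings of length at most the reach of the
`i`-th description at its probe. [cite: Ko1989, §3] -/
theorem mem_oracle_diagC_iff (i : ℕ) {s : List Bool}
    (hs : s.length ≤ (e i).reach (stageLvl S N₀ thr pick e i)) :
    s ∈ S.oracle (diagC S N₀ thr pick e) ↔ s ∈ S.oracle (diagSeq S N₀ thr pick e (i + 1)).C := by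
  refine S.mem_oracle_congr (fun m hm => ?_) hs
  exact diagC_eq_of_lt_lvl S N₀ thr pick e (hm.trans (reach_lt_lvl_succ_sig S N₀ thr pick e i))

variable {S}

/-- **The stage oracle has the shape `specLang`.** If all levels from `s.lvl` on carry the filler
and `n ≥ s.lvl`, then the oracle of `s.C` with level `n` set to `c` is
`specLang s.treated s.table n (blockLen n c) (fn n c)`: the treated levels are served by the table,
level `n` by `c`, every other level by the filler (the identity block).
[cite: AaronsonChen2017, Thm. 7.6 (proof, p. 30)] -/
theorem oracle_update_eq_specLang (s : ZState S)
    (hfill : ∀ m, s.lvl ≤ m → s.C m = S.filler) {n : ℕ} (hn : s.lvl ≤ n) (c : S.Γ) :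
    S.oracle (Function.update s.C n c) =
      specLang s.treated s.table n (S.blockLen n c) (S.fn n c) := by
  have hnE : n ∉ s.treated := fun h => by
    have := (ZState.mem_treated.1 h).1; omega
  have hfill' : ∀ m, m ∉ s.treated → s.C m = S.filler := by
    intro m hm
    by_cases hml : m < s.lvl
    · by_contra hne
      exact hm (ZState.mem_treated.2 ⟨hml, hne⟩)
    · exact hfill m (not_lt.1 hml)
  ext w
  rw [mem_specLang_iff, ContentSig.mem_oracle_iff]
  constructor
  · rintro ⟨m, hm⟩
    by_cases hmn : m = n
    · subst hmn
      rw [Function.update_self] at hm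
      exact Or.inr (Or.inl hm)
    · rw [Function.update_of_ne hmn] at hm
      by_cases hmt : m ∈ s.treated
      · exact Or.inl (ZState.mem_table.2 ⟨m, hmt, hm⟩)
      · refine Or.inr (Or.inr ⟨m, hmt, hmn, ?_⟩)
        rwa [hfill' m hmt, ContentSig.strings_filler] at hm
  · rintro (hT | hlev | ⟨m, hmt, hmn, hm⟩)
    · obtain ⟨m, hmt, hm⟩ := ZState.mem_table.1 hT
      have hmn : m ≠ n := fun h => hnE (h ▸ hmt)
      exact ⟨m, by rw [Function.update_of_ne hmn]; exact hm⟩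
    · exact ⟨n, by rw [Function.update_self]; exact hlev⟩
    · refine ⟨m, ?_⟩
      rw [Function.update_of_ne hmn, hfill' m hmt, ContentSig.strings_filler]
      exact hm

end Diag

/-! ### The generic assembly -/

/-- The descriptions with a polynomial-time machine form a countable set (the tree's
`exists_enum_PHDescr` fed with the discharged `countable_polyTimeOracleAlg_holds`).
[cite: AroraBarak2009, §1.4.1] -/
theorem exists_enum_PHDescr' :
    ∃ e : ℕ → PHDescr, {D : PHDescr | D.M.IsPolyTime encodingBoolBool} ⊆ Set.range e :=
  exists_enum_PHDescr countable_polyTimeOracleAlg_holds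

/-- **The generic `P/poly`-oracle separation.** For a content signature `S` with the quantum side
`SigQuantum`, the stage lemma `SigStage` and the `P/poly` bound `SigPPoly`, some oracle language
`O ∈ P/poly` has `BPP^O ≠ BQP^O` (the technique class `PPolyOracleSeparation`): `O = S.oracle diagC`
is the limit of the stages, `L = {x : N₀ ≤ |x|, isPerm (diagC |x|)}` is in `BQP^O`, and a `BPP^O`
machine `(M, q, p)` for `L` is defeated at the level of the stage treating `⟨[p], M, q⟩`, where its
acceptance probability at `1ⁿ` is on the wrong side of the `2/3`-promise (locality:
`accAt_congr`). [cite: AaronsonChen2017, Thm. 7.6 (proof, p. 30)] [cite: Ko1989, §3] -/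
theorem pPolyOracleSeparation_of_sig (S : ContentSig) (hQ : S.SigQuantum) (hS : S.SigStage)
    (hP : S.SigPPoly) : PPolyOracleSeparation := by
  classical
  -- the `BQP^O` machine and the first level
  obtain ⟨N₁, hN₁⟩ := hQ
  set N₀ : ℕ := N₁ with hN₀
  obtain ⟨D, hDu, hDlow, hD⟩ := hN₁ N₀ le_rfl
  -- enumeration of the descriptions, thresholds and picks of the stage lemma
  obtain ⟨e, he⟩ := exists_enum_PHDescr'
  have hstage : ∀ (E : Finset ℕ) (T : Finset (List Bool)) (Dd : PHDescr), ∃ n₁ : ℕ,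
      Dd.M.IsPolyTime encodingBoolBool → ∀ n, n₁ ≤ n → n ∉ E →
        ∃ c : S.Γ, S.Defeats E T Dd.M Dd.q (Dd.bounds.headD 0) n c := by
    intro E T Dd
    by_cases hM : Dd.M.IsPolyTime encodingBoolBool
    · obtain ⟨n₁, hn₁⟩ := hS Dd.M hM Dd.q (Dd.bounds.headD 0) E T
      exact ⟨n₁, fun _ => hn₁⟩
    · exact ⟨0, fun h => absurd h hM⟩
  choose thr hthr using hstage
  have hpick' : ∀ (E : Finset ℕ) (T : Finset (List Bool)) (Dd : PHDescr) (n : ℕ),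
      ∃ c : S.Γ, S.WellFormed n c ∧
        (Dd.M.IsPolyTime encodingBoolBool → thr E T Dd ≤ n → n ∉ E →
          S.Defeats E T Dd.M Dd.q (Dd.bounds.headD 0) n c) := by
    intro E T Dd n
    by_cases h : Dd.M.IsPolyTime encodingBoolBool ∧ thr E T Dd ≤ n ∧ n ∉ E
    · obtain ⟨c, hc⟩ := hthr E T Dd h.1 n h.2.1 h.2.2
      exact ⟨c, hc.1, fun _ _ _ => hc⟩
    · exact ⟨S.filler, S.wellFormed_filler n, fun h1 h2 h3 => absurd ⟨h1, h2, h3⟩ h⟩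
  choose pick hpickwf hpick using hpick'
  -- the contents, the oracle, the language
  set C : ℕ → S.Γ := diagC S N₀ thr pick e with hC
  set O : Language Bool := S.oracle C with hO
  set L : Language Bool := {x | N₀ ≤ x.length ∧ S.isPerm (C x.length) = true} with hL
  -- all contents are well formed
  have hwf : ∀ n, S.WellFormed n (C n) := by
    intro n
    rcases diagC_eq_filler_or S N₀ thr pick e n with h | ⟨j, hj, h⟩
    · rw [hC, h]; exact S.wellFormed_filler n
    · rw [hC, h, ← hj]
      exact hpickwf _ _ _ _
  refine ⟨O, hP C hwf, ?_⟩
  -- `L ∈ BQP^O`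
  have hLBQP : L ∈ BQPRel O := by
    refine ⟨D, hDu, fun x => ?_⟩
    by_cases hxn : N₀ ≤ x.length
    · have hagree : ∀ w ∈ levelDomain x.length, w ∈ O ↔ w ∈ S.strings x.length (C x.length) :=
        fun w hw => S.mem_oracle_iff_of_mem_levelDomain C hw
      have key := hD O x hxn (C x.length) (hwf x.length) hagree
      constructor
      · rintro ⟨-, hperm⟩
        exact key.1 hperm
      · intro hx
        have hx' : ¬ (N₀ ≤ x.length ∧ S.isPerm (C x.length) = true) := hx
        refine key.2 ?_
        cases hb : S.isPerm (C x.length)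
        · rfl
        · exact absurd ⟨hxn, hb⟩ hx'
    · have hlow := hDlow O x (lt_of_not_ge hxn)
      constructor
      · rintro ⟨h, -⟩; exact absurd h hxn
      · intro _; exact hlow
  -- `L ∉ BPP^O`
  intro hEq
  have hLBPP : L ∈ BPPRel (Oracle.ofLanguage O) := by rw [hEq]; exact hLBQP
  obtain ⟨L', hL'P, p, hp⟩ := hLBPP
  obtain ⟨M, hM, q, hq⟩ := hL'P
  have hbase : baseLang M q O = L' := baseLang_eq_of_PRel hq
  -- its description `⟨[p], M, q⟩` is some `e i`; stage `i` defeated it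
  obtain ⟨i, hi⟩ := he (show (⟨[p], M, q⟩ : PHDescr) ∈
    {Dd : PHDescr | Dd.M.IsPolyTime encodingBoolBool} from hM)
  set s := diagSeq S N₀ thr pick e i with hs
  set n := stageLvl S N₀ thr pick e i with hndef
  have heM : (e i).M = M := by rw [hi]
  have heq : (e i).q = q := by rw [hi]
  have hep : (e i).bounds.headD 0 = p := by rw [hi]; rfl
  have hnE : n ∉ s.treated := fun h => by
    have h1 := (ZState.mem_treated.1 h).1
    have h2 := lvl_le_stageLvl S N₀ thr pick e i
    rw [← hs, ← hndef] at h2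
    omega
  have hdef : S.Defeats s.treated s.table M q p n (stagePick S N₀ thr pick e i) := by
    have := hpick s.treated s.table (e i) n (by rw [heM]; exact hM)
      (thr_le_stageLvl S N₀ thr pick e i) hnE
    rwa [heM, heq, hep] at this
  obtain ⟨-, ht, hf⟩ := hdef
  have hN₀n : N₀ ≤ n :=
    le_trans (le_trans (Nat.le_add_right N₀ i) (add_le_lvl S N₀ thr pick e i))
      (lvl_le_stageLvl S N₀ thr pick e i)
  have hCn : C n = stagePick S N₀ thr pick e i := by
    rw [hC]; exact diagC_stageLvl S N₀ thr pick e i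
  -- the stage oracle and the limit oracle agree below the reach
  have hspec : S.oracle (diagSeq S N₀ thr pick e (i + 1)).C =
      specLang s.treated s.table n (S.blockLen n (stagePick S N₀ thr pick e i))
        (S.fn n (stagePick S N₀ thr pick e i)) := by
    rw [diagSeq_succ_C]
    exact oracle_update_eq_specLang s
      (fun m hm => C_eq_filler_of_lvl_le S N₀ thr pick e i hm)
      (lvl_le_stageLvl S N₀ thr pick e i) _
  have hloc : accAt M q p O n =
      accAt M q p (specLang s.treated s.table n (S.blockLen n (stagePick S N₀ thr pick e i))
        (S.fn n (stagePick S N₀ thr pick e i))) n := by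
    rw [← hspec]
    refine accAt_congr M q p n fun w hw => ?_
    rw [hO, hC]
    refine mem_oracle_diagC_iff S N₀ thr pick e i ?_
    rw [hi]; exact hw
  -- membership of `1ⁿ` in `L` versus the promise of the `BPP^O` machine
  have hlen : (List.replicate n true).length = n := List.length_replicate
  have hprob := hp (List.replicate n true)
  rw [hlen] at hprob
  have hmemL : List.replicate n true ∈ L ↔ S.isPerm (stagePick S N₀ thr pick e i) = true := by
    change (N₀ ≤ (List.replicate n true).length ∧ S.isPerm (C (List.replicate n true).length) = true) ↔ _
    rw [hlen, hCn]
    exact ⟨fun h => h.2, fun h => ⟨hN₀n, h⟩⟩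
  cases hβ : S.isPerm (stagePick S N₀ thr pick e i)
  · -- a non-permutation level: `1ⁿ ∉ L`, yet `M` accepts with probability `> 1/3`
    have hacc := hf hβ
    have hnot : List.replicate n true ∉ L := fun h => by simpa [hβ] using hmemL.1 h
    have hset : {y : List Bool | boolPair (List.replicate n true) y ∈ L' ↔ List.replicate n true ∈ L} =
        {y : List Bool | boolPair (List.replicate n true) y ∈ baseLang M q O}ᶜ := by
      ext y
      simp only [Set.mem_setOf_eq, Set.mem_compl_iff, hbase, iff_false_right hnot]
    rw [hset, Literature.Computability.Complexity.uniformProb_compl] at hprob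
    change 2 / 3 ≤ 1 - accAt M q p O n at hprob
    rw [hloc] at hprob
    linarith
  · -- a permutation level: `1ⁿ ∈ L`, yet `M` accepts with probability `< 2/3`
    have hacc := ht hβ
    have hmem : List.replicate n true ∈ L := hmemL.2 hβ
    have hset : {y : List Bool | boolPair (List.replicate n true) y ∈ L' ↔ List.replicate n true ∈ L} =
        {y : List Bool | boolPair (List.replicate n true) y ∈ baseLang M q O} := by
      ext y
      simp only [Set.mem_setOf_eq, hbase, iff_true_right hmem]
    rw [hset] at hprob
    change 2 / 3 ≤ accAt M q p O n at hprob
    rw [hloc] at hprob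
    linarith

/-! ### The Zhandry instantiation: contents `LevelContent` -/

section Zhandry

variable {F : FunctionEnsemble} {κ ℓ : ℕ → ℕ}

variable (F κ ℓ) in
/-- **Zhandry's contents as a content signature**: `Γ = LevelContent` (`filler`, `prp k`,
`prfmod k a`) with the block lengths, level functions and well-formedness of `ZhandryOracle.lean`.
[cite: AaronsonChen2017, §7.2 and Thm. 7.6 (proof, p. 30)] -/
def zhandrySig : ContentSig where
  Γ := LevelContent
  filler := LevelContent.filler
  isPerm := LevelContent.isPerm
  blockLen n c := c.blockLen ℓ n
  fn n c := c.fn F ℓ n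
  WellFormed n c := c.WellFormed κ ℓ n
  blockLen_filler _ := rfl
  fn_filler _ := rfl
  wellFormed_filler _ := trivial

/-- The oracle of the Zhandry signature is `zhandryOracle` (definitional). [folklore] -/
theorem zhandrySig_oracle (C : ℕ → LevelContent) :
    (zhandrySig F κ ℓ).oracle C = zhandryOracle F ℓ C :=
  rfl

/-- **The stage lemma** (Thm. 7.6, proof: "no `BPP` machine can distinguish `PRP^raw_{K^raw}` and
`PRF^mod_{K^mod}` with a non-negligible advantage. So let `M` be a `BPP` machine …
`Pr_O[E_n(M)] = ½ + o(1)`"). For a secure `PRP^raw = (F, κ, ℓ)` with `n ≤ ℓ n ≤ B n`, a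
polynomial-time `M` with bounds `q, p` and finite data `(E, T)`: from some level on, at every level
`n ∉ E` some content defeats `(M, q, p)`. Proof: the PPT adversary `𝒜` of
`aaronsonChen2017_thm76_bppMachine` has `prfRealProb = 2^{-κ n} ∑_k accAt(prp k)` and
`prfModRealProb = (2^{κ n} |A|)^{-1} ∑_{k,a} accAt(prfmod k a)`; if no content defeated
`(M, q, p)` the first average would be `≥ 2/3` and the second `≤ 1/3`, contradicting
`|prfRealProb − prfModRealProb| ≤ 1/6` (`aaronsonChen2017_lem75_eventually_le`).
[cite: AaronsonChen2017, Thm. 7.6 (proof, p. 30) and Lemma 7.5 (1)] -/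
theorem exists_defeating_content (h₁ : aaronsonChen2017_lem75_prp_isPRF)
    (h₂ : aaronsonChen2017_lem75_prfMod_isPRF) (h₃ : aaronsonChen2017_thm76_bppMachine)
    (hF : IsPRP F κ ℓ) (hℓ : ∀ n, n ≤ ℓ n) {B : Polynomial ℕ} (hB : ∀ n, ℓ n ≤ B.eval n)
    {M : OracleAlg Bool} (hM : M.IsPolyTime encodingBoolBool) (q p : Polynomial ℕ)
    (E : Finset ℕ) (T : Finset (List Bool)) :
    ∃ n₁ : ℕ, ∀ n, n₁ ≤ n → n ∉ E →
      ∃ c : LevelContent, (zhandrySig F κ ℓ).Defeats E T M q p n c := by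
  classical
  obtain ⟨𝒜, h𝒜, hsim⟩ := h₃ M hM q p B E T
  obtain ⟨n₀, hn₀⟩ := aaronsonChen2017_lem75_eventually_le h₁ h₂ hF hℓ h𝒜
    (δ := 1 / 6) (by norm_num)
  refine ⟨max n₀ 4, fun n hn hnE => ?_⟩
  have hn₀' : n₀ ≤ n := (le_max_left _ _).trans hn
  have hn4 : 4 ≤ n := (le_max_right _ _).trans hn
  have hEff : IsEfficientFamily F κ ℓ ℓ := hF.isEfficientFamily
  -- the simulation identity at level `n`, block length `ℓ n`
  have hsim' : ∀ f : List Bool → List Bool, (∀ y : List Bool, y.length = ℓ n → (f y).length = ℓ n) →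
      𝒜.acceptProb (oracleOfFnAt (ℓ n) f) n = accAt M q p (specLang E T n (ℓ n) f) n := by
    intro f hf
    rw [accAt_eq_run]
    exact hsim n (ℓ n) f hnE (le_trans (by omega) (hℓ n)) (hB n) hf
  -- the moduli set is nonempty
  have hA : (zhandryModuli (2 ^ ℓ n)).Nonempty :=
    zhandryModuli_two_pow_nonempty (le_trans hn4 (hℓ n))
  by_contra H
  push Not at H
  -- every `prp k` is accepted with probability `≥ 2/3`
  have hprp : ∀ k : List.Vector Bool (κ n),
      2 / 3 ≤ 𝒜.acceptProb (oracleOfFnAt (ℓ n) (F n k.toList)) n := by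
    intro k
    have hk : k.toList.length = κ n := k.toList_length
    rw [hsim' (F n k.toList) (fun y hy => hEff.2.2 n k.toList y hk hy)]
    by_contra hlt
    push Not at hlt
    refine H (LevelContent.prp k.toList) ⟨(LevelContent.wellFormed_prp_iff κ ℓ n _).2 hk,
      fun _ => ?_, fun h => ?_⟩
    · simpa [zhandrySig] using hlt
    · simp [zhandrySig] at h
  -- every `prfmod k a` is accepted with probability `≤ 1/3`
  have hmod : ∀ (k : List.Vector Bool (κ n)) (a : ℕ), a ∈ zhandryModuli (2 ^ ℓ n) →
      𝒜.acceptProb (oracleOfFnAt (ℓ n) (prfMod F ℓ n k.toList a)) n ≤ 1 / 3 := by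
    intro k a ha
    have hk : k.toList.length = κ n := k.toList_length
    rw [hsim' (prfMod F ℓ n k.toList a) (fun y _ => length_prfMod hEff n hk a y)]
    by_contra hlt
    push Not at hlt
    refine H (LevelContent.prfmod k.toList a)
      ⟨(LevelContent.wellFormed_prfmod_iff κ ℓ n _ _).2 ⟨hk, ha⟩, fun h => ?_, fun _ => ?_⟩
    · simp [zhandrySig] at h
    · simpa [zhandrySig] using hlt
  -- hence the real games differ by at least `1/3`
  have hreal : 2 / 3 ≤ prfRealProb F κ ℓ 𝒜 n := by
    rw [prfRealProb_eq_sum, le_div_iff₀ (by positivity)]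
    have h := Finset.card_nsmul_le_sum Finset.univ
      (fun k : List.Vector Bool (κ n) => 𝒜.acceptProb (oracleOfFnAt (ℓ n) (F n k.toList)) n) (2 / 3)
      (fun k _ => hprp k)
    rw [nsmul_eq_mul, Finset.card_univ, card_vector, Fintype.card_bool] at h
    push_cast at h
    linarith [h]
  have hmodp : prfModRealProb F κ ℓ 𝒜 n ≤ 1 / 3 := by
    unfold prfModRealProb
    have hden : (0 : ℝ) < 2 ^ κ n * ((zhandryModuli (2 ^ ℓ n)).card : ℝ) := by
      have : (0 : ℝ) < (zhandryModuli (2 ^ ℓ n)).card := by exact_mod_cast hA.card_pos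
      positivity
    rw [div_le_iff₀ hden]
    calc ∑ k : List.Vector Bool (κ n), ∑ a ∈ zhandryModuli (2 ^ ℓ n),
          𝒜.acceptProb (oracleOfFnAt (ℓ n) (prfMod F ℓ n k.toList a)) n
        ≤ ∑ _k : List.Vector Bool (κ n), ∑ _a ∈ zhandryModuli (2 ^ ℓ n), (1 / 3 : ℝ) :=
          Finset.sum_le_sum fun k _ => Finset.sum_le_sum fun a ha => hmod k a ha
      _ = 1 / 3 * (2 ^ κ n * ((zhandryModuli (2 ^ ℓ n)).card : ℝ)) := by
          simp only [Finset.sum_const, Finset.card_univ, card_vector, Fintype.card_bool, nsmul_eq_mul]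
          push_cast
          ring
  have hgap := hn₀ n hn₀'
  rw [abs_le] at hgap
  linarith [hgap.1, hgap.2]

/-- **`SigStage` for Zhandry's contents** from Lemma 7.5 (1) and the PPT simulation (the stage
lemma, with the probe bound `B = q_F + X` dominating `ℓ`).
[cite: AaronsonChen2017, Thm. 7.6 (proof, p. 30) and Lemma 7.5 (1)] -/
theorem sigStage_zhandry (h₁ : aaronsonChen2017_lem75_prp_isPRF)
    (h₂ : aaronsonChen2017_lem75_prfMod_isPRF) (h₃ : aaronsonChen2017_thm76_bppMachine)
    (hF : IsPRP F κ ℓ) (hℓ : ∀ n, n ≤ ℓ n) : (zhandrySig F κ ℓ).SigStage := by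
  obtain ⟨qB, hqB⟩ := hF.isEfficientFamily.2.1
  intro M hM q p E T
  exact exists_defeating_content h₁ h₂ h₃ hF hℓ (B := qB) (fun n => (hqB n).2.1) hM q p E T

/-- **`SigQuantum` for Zhandry's contents** from Lemma 7.5 (2)–(3) (`aaronsonChen2017_lem75_quantum`
with the probe bound `B = q_F + X ≥ ℓ n, n`): a well-formed permutation level is the identity of
`{0,1}ⁿ` (filler) or `PRP^raw_k`, injective on its block (`IsPRP.injOn`), so clause (i) applies;
a well-formed `prfmod k a` level is `PRP^raw_k ∘ modReduce (ℓ n) a` with `a ∈ A`, so clause (ii)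
applies. [cite: AaronsonChen2017, Lemma 7.5 (2)–(3) and Thm. 7.6 (proof, p. 30)] -/
theorem sigQuantum_zhandry (hQ : Literature.Computability.Cryptography.aaronsonChen2017_lem75_quantum) (hF : IsPRP F κ ℓ)
    (hℓ : ∀ n, n ≤ ℓ n) : (zhandrySig F κ ℓ).SigQuantum := by
  have hEff : IsEfficientFamily F κ ℓ ℓ := hF.isEfficientFamily
  obtain ⟨qB, hqB⟩ := hEff.2.1
  set B : Polynomial ℕ := qB + Polynomial.X with hBdef
  have hB : ∀ n, ℓ n ≤ B.eval n := fun n => by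
    have := (hqB n).2.1
    simp only [hBdef, Polynomial.eval_add, Polynomial.eval_X]; omega
  have hBn : ∀ n, n ≤ B.eval n := fun n => by
    simp only [hBdef, Polynomial.eval_add, Polynomial.eval_X]; omega
  obtain ⟨N₁, hN₁⟩ := hQ B
  refine ⟨N₁, fun n₀ hn₀ => ?_⟩
  obtain ⟨D, hDu, hDlow, hD⟩ := hN₁ n₀ hn₀
  refine ⟨D, hDu, hDlow, fun O x hxn c hwf hagree => ?_⟩
  rcases c with _ | k | ⟨k, a⟩
  · -- filler: the identity permutation of `{0,1}^{|x|}`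
    refine ⟨fun _ => ?_, fun h => by simp [zhandrySig] at h⟩
    exact (hD O x hxn x.length id le_rfl (hBn _) (fun y hy => hy) hagree).1 (Set.injOn_id _)
  · -- `PRP^raw_k`: injective on the block
    have hk : k.length = κ x.length := hwf
    refine ⟨fun _ => ?_, fun h => by simp [zhandrySig] at h⟩
    exact (hD O x hxn (ℓ x.length) (F x.length k) (hℓ _) (hB _)
      (fun y hy => hEff.2.2 x.length k y hk hy) hagree).1 (hF.injOn x.length hk)
  · -- `PRF^mod_{(k,a)} = PRP^raw_k ∘ (· mod a)`
    have hk : k.length = κ x.length ∧ a ∈ zhandryModuli (2 ^ ℓ x.length) := hwf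
    refine ⟨fun h => by simp [zhandrySig] at h, fun _ => ?_⟩
    exact (hD O x hxn (ℓ x.length) (prfMod F ℓ x.length k a) (hℓ _) (hB _)
      (fun y _ => length_prfMod hEff x.length hk.1 a y) hagree).2
      ⟨F x.length k, a, hk.2, hF.injOn x.length hk.1, fun y _ => rfl⟩

/-- **`SigPPoly` for Zhandry's contents** is `aaronsonChen2017_thm76_memPPoly`.
[cite: AaronsonChen2017, Thm. 7.6 (proof, p. 30)] -/
theorem sigPPoly_zhandry (h₄ : aaronsonChen2017_thm76_memPPoly) (hEff : IsEfficientFamily F κ ℓ ℓ) :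
    (zhandrySig F κ ℓ).SigPPoly := fun C hC =>
  h₄ F κ ℓ hEff C hC

end Zhandry

/-- **Aaronson–Chen 2017, Thm. 7.6 from a secure PRP, from the leaves.** Given Lemma 7.5 (1)
(`aaronsonChen2017_lem75_prp_isPRF`, `aaronsonChen2017_lem75_prfMod_isPRF`), Lemma 7.5 (2)–(3) as
the `BQP^O` machine (`aaronsonChen2017_lem75_quantum`), the PPT simulation of `BPP^O` machines at
the probe (`aaronsonChen2017_thm76_bppMachine`) and `O ∈ P/poly`
(`aaronsonChen2017_thm76_memPPoly`): every secure pseudorandom permutation with block length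
`ℓ n ≥ n` yields an oracle language `O ∈ P/poly` with `BPP^O ≠ BQP^O` (the generic
diagonalization `pPolyOracleSeparation_of_sig` at the Zhandry signature).
[cite: AaronsonChen2017, Thm. 7.6 (p. 30)] [cite: Ko1989, §3] -/
theorem aaronsonChen2017_thm76_of_prp_of_sig_leaves (h₁ : aaronsonChen2017_lem75_prp_isPRF)
    (h₂ : aaronsonChen2017_lem75_prfMod_isPRF) (hQ : Literature.Computability.Cryptography.aaronsonChen2017_lem75_quantum)
    (h₃ : aaronsonChen2017_thm76_bppMachine) (h₄ : aaronsonChen2017_thm76_memPPoly) :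
    aaronsonChen2017_thm76_of_prp := by
  rintro ⟨F, κ, ℓ, hF, hℓ⟩
  exact pPolyOracleSeparation_of_sig (zhandrySig F κ ℓ) (sigQuantum_zhandry hQ hF hℓ)
    (sigStage_zhandry h₁ h₂ h₃ hF hℓ) (sigPPoly_zhandry h₄ hF.isEfficientFamily)

end Literature.Barriers.QuantumAdvantage

end
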